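import Literature.AlgebraicGeometry.Resolution.DerivativeIdealsFieldChange
import Literature.AlgebraicGeometry.Resolution.KollarTripleMaxOrd
import HarnessLib

/-!
# Orders of ideals are invariant under changes of fields (Kollár 2007, 3.34.2 with 3.47)

Topic: `Literature/AlgebraicGeometry/Resolution`. Shared infrastructure for the decomposition of
the named fact `Kollar2007Thm3_107` (`KollarBlowupSequenceFunctors.lean`; J. Kollár, *Lectures on
Resolution of Singularities*, Ann. of Math. Stud. 166 (2007)). The functors of Thms. 3.68 / 3.69
must "commute with change of fields" (3.34.2, p. 131 of the held copy): for a field extension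
`σ : K → L` and `T' = (X_{L,σ}, I_{L,σ}, E_{L,σ})` the pulled-back sequence is the value at `T'`.
Every level/class bookkeeping of the inductive proof of 3.107 (`max-ord N(I) ≤ μ`,
`KollarFunctorIteration.descend`) therefore needs that ORDERS DO NOT CHANGE under
`g : X_{L,σ} → X_K`: `ord_{x'} g^*J = ord_{g x'} J`. Kollár takes this for granted ("This
property will hold automatically for all blow-up sequence functors that we construct"); here it
is PROVED in characteristic zero from the tree's Lemma 3.5.2 of BGMW
(`supp(J, μ) = V(𝒟^{μ-1} J)`, `DerivativeIdealsSupport.lean`) and the commutation of derivative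
ideals with change of fields (`comap_derivIdealSheafIter_of_isFieldChange`,
`DerivativeIdealsFieldChange.lean`):

* `Kollar2007.Triple.support_marked_eq_support_deriv` — on a triple in characteristic zero,
  `supp(J, μ) = V(𝒟^{μ-1} J)` for `μ ≥ 1` and ANY ideal sheaf `J`;
* **`Kollar2007.Triple.IsFieldChange.le_idealOrder_comap_iff`,
  `Kollar2007.Triple.IsFieldChange.idealOrder_comap`** — `ord_{x'}(g^*J) = ord_{g x'}(J)`;
* `Kollar2007.Triple.IsFieldChange.surjective` — `g` is surjective;
  **`Kollar2007.Triple.IsFieldChange.maxOrd_comap`** — `max-ord g^*J = max-ord J`;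
  `Kollar2007.Triple.IsFieldChange.maxOrdLE_iff` — `max-ord I_{L,σ} ≤ m ↔ max-ord I ≤ m`;
  `Kollar2007.Triple.IsFieldChange.support_marked_comap` — `cosupp(g^*J, μ) = g^{-1} cosupp(J, μ)`.

## Sources

* J. Kollár, *Lectures on Resolution of Singularities* (2007), 3.34.2 (p. 131), Def. 3.47
  (p. 137 of the held copy). [Kollar2007]
* E. Bierstone, D. Grigoriev, P. Milman, J. Włodarczyk, arXiv:1206.3090, Lemma 3.5.2 (p. 8).
  [BierstoneGrigorievMilmanWlodarczyk2011]
-/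

noncomputable section

open CategoryTheory CategoryTheory.Limits AlgebraicGeometry TopologicalSpace

namespace Literature.AlgebraicGeometry.Resolution

universe u

namespace Kollar2007.Triple

variable {K L : Type u} [Field K] [Field L] {n : ℕ}

/-- **`supp(J, μ) = V(𝒟^{μ-1} J)` on a triple in characteristic zero** (BGMW Lemma 3.5.2 for the
smooth `X → Spec K`), for every ideal sheaf `J` and `μ ≥ 1`.
[cite: BierstoneGrigorievMilmanWlodarczyk2011, Lemma 3.5.2 (p. 8)] -/
theorem support_marked_eq_support_deriv [CharZero K] (T : Triple K n) (J : T.X.IdealSheafData)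
    (E : List T.X.IdealSheafData) {μ : ℕ} (hμ : 1 ≤ μ) :
    (⟨J, E, μ⟩ : MarkedIdeal T.X).support =
      ((derivIdealSheafIter T.kHom (μ - 1) J).support : Set T.X) := by
  letI : T.X.Over (Spec (.of K)) := ⟨T.struct⟩
  haveI : Smooth (T.X ↘ Spec (.of K)) := T.smooth_struct
  haveI : CharP K 0 := CharP.ofCharZero K
  exact MarkedIdeal.support_eq_support_derivIdealSheafIter
    (hasFinitePresentationDifferentials_overHom K T.X) (hasLocalCoordinates_overHom K T.X)
    ⟨J, E, μ⟩ (fun x j hj _ => isUnit_natCast_stalk_overHom K T.X 0 x hj (Or.inl rfl)) hμ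

variable [CharZero K] {σ : K →+* L} {T : Triple K n} {T' : Triple L n} {g : T'.X ⟶ T.X}

/-- **Orders do not change under a change of fields**: `ord_{x'}(g^*J) ≥ μ ↔ ord_{g x'}(J) ≥ μ`
(`supp(·, μ) = V(𝒟^{μ-1} ·)` on both sides and `g^*𝒟^{μ-1}J = 𝒟^{μ-1} g^*J`).
[cite: Kollar2007, 3.34.2 (p. 131) with Def. 3.47 (p. 137)] -/
theorem IsFieldChange.le_idealOrder_comap_iff (hF : IsFieldChange σ T T' g)
    (J : T.X.IdealSheafData) (x' : T'.X) (μ : ℕ) :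
    (μ : ℕ∞) ≤ idealOrder (J.comap g) x' ↔ (μ : ℕ∞) ≤ idealOrder J (g.base x') := by
  rcases Nat.eq_zero_or_pos μ with rfl | hμ
  · simp
  haveI : CharZero L := (RingHom.charZero_iff σ.injective).mp inferInstance
  have e := comap_derivIdealSheafIter_of_isFieldChange σ hF (μ - 1) J
  show x' ∈ (⟨J.comap g, [], μ⟩ : MarkedIdeal T'.X).support ↔
    g.base x' ∈ (⟨J, [], μ⟩ : MarkedIdeal T.X).support
  rw [T'.support_marked_eq_support_deriv (J.comap g) [] hμ, T.support_marked_eq_support_deriv J [] hμ,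
    ← e, SetLike.mem_coe, SetLike.mem_coe, Scheme.IdealSheafData.support_comap]
  rfl

/-- **`ord_{x'}(g^*J) = ord_{g x'}(J)`** under a change of fields.
[cite: Kollar2007, 3.34.2 (p. 131) with Def. 3.47 (p. 137)] -/
theorem IsFieldChange.idealOrder_comap (hF : IsFieldChange σ T T' g) (J : T.X.IdealSheafData)
    (x' : T'.X) : idealOrder (J.comap g) x' = idealOrder J (g.base x') :=
  ENat.eq_of_forall_natCast_le_iff fun μ => hF.le_idealOrder_comap_iff J x' μ

/-- The cosupports correspond: `cosupp(g^*J, μ) = g^{-1} cosupp(J, μ)`.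
[cite: Kollar2007, 3.34.2 (p. 131)] -/
theorem IsFieldChange.mem_support_marked_comap_iff (hF : IsFieldChange σ T T' g)
    (J : T.X.IdealSheafData) (E' : List T'.X.IdealSheafData) (E : List T.X.IdealSheafData)
    (μ : ℕ) (x' : T'.X) :
    x' ∈ (⟨J.comap g, E', μ⟩ : MarkedIdeal T'.X).support ↔
      g.base x' ∈ (⟨J, E, μ⟩ : MarkedIdeal T.X).support :=
  hF.le_idealOrder_comap_iff J x' μ

omit [CharZero K] in
/-- A change of fields `X_{L,σ} → X_K` is surjective (base change of the surjection
`Spec L → Spec K`). [cite: Kollar2007, 3.34.2 (p. 131)] -/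
theorem IsFieldChange.surjective (hF : IsFieldChange σ T T' g) : Surjective g := by
  haveI : Surjective (Spec.map (CommRingCat.ofHom σ)) := by
    refine ⟨fun x => ?_⟩
    haveI : Nonempty (Spec (.of L) : Scheme.{u}) := ⟨(⊥ : PrimeSpectrum L)⟩
    exact ⟨Classical.arbitrary _, Subsingleton.elim _ _⟩
  exact MorphismProperty.of_isPullback (P := @Surjective) hF.isPullback.flip inferInstance

/-- **`max-ord g^*J = max-ord J`** under a change of fields.
[cite: Kollar2007, 3.34.2 (p. 131) with Def. 3.47 (p. 137)] -/
theorem IsFieldChange.maxOrd_comap (hF : IsFieldChange σ T T' g) (J : T.X.IdealSheafData) :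
    maxOrd (J.comap g) = maxOrd J := by
  refine le_antisymm (maxOrd_le_iff.mpr fun x' => ?_) (maxOrd_le_iff.mpr fun x => ?_)
  · rw [hF.idealOrder_comap J x']
    exact idealOrder_le_maxOrd J _
  · haveI := hF.surjective
    obtain ⟨x', rfl⟩ := g.surjective x
    rw [← hF.idealOrder_comap J x']
    exact idealOrder_le_maxOrd _ _

/-- `max-ord I_{L,σ} ≤ m ↔ max-ord I ≤ m`: the class of Thm. 3.68 is invariant under changes of
fields. [cite: Kollar2007, 3.34.2 (p. 131) with Thm. 3.68 (p. 150)] -/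
theorem IsFieldChange.maxOrdLE_iff (hF : IsFieldChange σ T T' g) (m : ℕ) :
    T'.MaxOrdLE m ↔ T.MaxOrdLE m := by
  rw [T'.maxOrdLE_iff, T.maxOrdLE_iff, hF.ideal_eq, hF.maxOrd_comap]

end Kollar2007.Triple

end Literature.AlgebraicGeometry.Resolution

end
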